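import Summits.QuantumFields.BalabanUV.Beta.VariantCutoffRoad
import Summits.QuantumFields.BalabanUV.Beta.RemainderExplicitEnd

/-!
# Beta / VariantCutoffRoadExplicit — BINDER-OWNERS row D4: ROAD P3 ⊕ ROAD P2″ — co-owner #3's ONE residual (R) relative to
# the EXPLICIT carrier, READ AT the [III] (3.16) cut-off `ε₁ ↦ δ(g_k) = A₁g_k(log g_k⁻²)^{p₀}`, gives the wall END with NEITHER
# (E), (V) NOR the threshold (hr): «(D4)-END ⇐ (R at δ_k) ∧ ε₁-free numerics ∧ c.δ₀ ≤ δ₀⋆» (unit `b2b-balaban-beta-d4-p2`, gen 3)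

HONEST FRAMING (page 1 of everything the β sub-cell writes): discharging `BetaPertH` makes Bałaban's UV stability
UNCONDITIONAL — a real constructive-QFT result; it is NOT the continuum limit and NOT the Clay problem.  HONEST DEPENDENCY
(cell reorg 2026-08-19, verbatim): «continuum YM on T⁴ ⇐ BetaPertH ∧ nine spine estimates (0/9 proved); BetaPertH ⇐ (D1) ∧
(D4) ∧ CAP+tail; G-an2-4 gates asym, D1 and NE2/3/4.»  THIS MODULE INSTANTIATES NO BINDER AND ASSERTS NOTHING ABOUT
BAŁABAN'S DENSITIES OR β-FUNCTIONS: every declaration is a `rfl`-level fact about the constants record, a HYPOTHESIS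
STRUCTURE (displayed hypotheses, never facts), or a theorem proved from the UNMODIFIED tree modules `Beta.RemainderLocality`
(row owner an4: `PolLeavesTFac.toPolLeavesT`), `RemainderExplicitRoad` / `RemainderExplicitCarrier` / `RemainderExplicitEnd`
(co-owner #3, unit `b2b-balaban-beta-d4-p3`: `ExplicitCarrier`, `Residual`, `ResidualChain`, `carrierBal`,
`exists_decay_carrierBal`, `limit_carrierBal`, `carrierFamily`) and `VariantCutoffRoad` (this unit, gen 2: `withEps`,
`deltaOf`, `Hyps`, `ChainTδ`, `endpointExistence_of_chainTδ`), imported BY NAME.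

ABSOLUTE RULE (cell charter, verbatim): "No internally-minted statement may enter as a cited fact. Every hypothesis is
either kernel-proved in this package or a verbatim quotation of a PUBLISHED theorem with page reference. The manuscript(s)
under audit are NOT citable for their own disputed steps — they are the thing under adjudication; programme-internal
(2001/route/tribunal) claims are never citable."  Nothing is cited as a fact here.

## What the three co-owner roads of row D4 had typed before this module (all kernel, 0 sorry)

* ROAD P1 (row owner an4): `RemainderLocality.ChainTFac.abs_beta1_le` — the leaf list at [II]'s constants record `c`
  ⟹ CONSTANT form `RemainderConst S γ (ε₁·K_rem,L)`; the wall END needs the inserted threshold N3 / (hr)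
  `ε₁·K_rem,L ≤ stepBal N Lc` (certified SHARP for the constant form, `RemainderThresholdSharp`).
* ROAD P3 (co-owner #3): the leaf list CUT into an EXPLICIT carrier `𝔈` (test configurations = the typed `U = 1`
  minimiser columns, CONSTRUCTED: `carrierBal`, with (E) k-uniform decay and (V) volume limit PROVED) and ONE residual
  hypothesis structure `Residual 𝔈 a c ℓ α₂` / `ResidualChain … c … 𝔈` = exactly what Bałaban's densities must satisfy
  relative to the carrier; END `RemainderExplicitEnd.endpointExistence_of_residualChain_carrierBal` — constant form, (E)
  and (V) discharged, (hr) KEPT («`hr` stays the printed-type restriction on ε₁»).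
* ROAD P2″ (this unit): [II]'s constants record READ AT `ε₁ := δ(g_k)` per scale and history ([II]'s every printed ε₁
  is the majorant of `g_k|B|` on the small-field box or the (2.3) threshold — audit `AUDIT-EPS1-PROVENANCE.md`, 27 rows,
  referee light cross-read #71 6/6 verbatim; on the (3.16) box `|B| < r_k` of [Balaban1988Convergent] that majorant is
  [III]'s own `δ_k = g_k r_k`) ⟹ ω-FORM `RemainderMod S γ (δ(·)·K_rem,L)`, `δ(g) → 0` ⟹ END with NO (hr), NO N3
  (`VariantCutoffRoad.endpointExistence_of_chainTδ`), on the owner's torus leaf list `PolLeavesT` (abstract carrier).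

## What this module adds (pure composition, ≈ one token per field)

§2 `ResidualChainδ … c ℓ α₂ A₁ p₀ 𝔈` := road P3's `Residual (𝔈 k) (A1 k p) (withEps c (δ(g_k))) ℓ α₂` per scale `k`
and history `p` — co-owner #3's ONE residual with its Lemma-3 field `h238` displayed at `C₃·δ(g_k)` (the ONLY field of
`Residual` that mentions the constants record).  §3 `ResidualChainδ.toChainTδ` := `Residual.toPolLeavesTFac` (P3) ∘
`PolLeavesTFac.toPolLeavesT` (P1) at the substituted record ∘ `ChainTδ` (P2″) ⟹ `abs_beta1_le : RemainderMod S γ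
(fun g ↦ δ(g)·remCoeffL d M c α₂ B₃)`; consistency `toResidualChain`: a δ-chain on `]0,γ]` IS a road-P3 chain at the
top-of-box slot `withEps c (δ γ)` (Lemma 3's bound is monotone in the slot), so road P3's own END reproduces the constant
form `remainderConst` — the two roads agree where they overlap.  §4 the wall END from `ResidualChainδ` for ANY explicit
carrier family with (E), (V) as hypotheses: NO (hr) (`endpointExistence_of_residualChainδ`, drift letters; `…_D1Drift`,
wall letters, where `0 < stepBal N Lc` is read from `0 < N`, `1 < Lc`).  §5 (d = 4) for co-owner #3's CONSTRUCTED family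
`carrierFamily Lc Mc Nn hN μ ν`: (E), (V) discharged by `exists_decay_carrierBal` / `limit_carrierBal` BY NAME ⟹
`endpointExistence_of_residualChainδ_carrierBal : ∃ δ₀⋆ B₃, 0 < δ₀⋆ ∧ 0 ≤ B₃ ∧ (ResidualChainδ … (carrierFamily …) →
c.δ₀ ≤ δ₀⋆ → EndpointExistence Cn)` — LITERALLY road P3's `endpointExistence_of_residualChain_carrierBal` with the
hypothesis `c.ε₁ * remCoeffL 4 Mc c α₂ B₃ ≤ B12Normalization.stepBal N Lc` DELETED (and the wall's `0 < N`, `1 < Lc`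
added).  So, after this module, the STRONGEST typed END of row D4 reads: (D4)-END ⇐ (R at δ_k, relative to the explicit
carrier) ∧ the ε₁-free numerics `Hyps` ∧ signs ∧ `c.δ₀ ≤ δ₀⋆` — no (E), no (V), no (hr), no N3.

WHAT STAYS LOCATED (unchanged; this module adds NO leaf and removes none of the CONTENT leaves): (R) itself = road P1's
NODE O (Bałaban's small-field step objects — for road P2″ those of the (3.16)-cut-off VARIANT, cell DIVERGENCE D-d4p2-1,
row-owner census `BETA/REMAINDER-BETA.md` v3.14 §10.14 V14 with V14-a/b/c) + NODE A ([II] Lemma 3 itself: (T1) ⇐ (T2)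
G-IF-10 ⇐ (T3) G-B9-10 [MEDIUM], (T4) columns, (T5)/(T6) LOW) + NODE B ((4.4) seam, analyticity) + (4.35) along co-owner
#3's explicit columns + (1.7); size XL, unowned.  D4 DISCHARGE: NO DATE.  NOT `BetaPertH`, NOT continuum, NOT Clay, NOT
summit progress.
-/

namespace Summit.QuantumFields.BalabanUV.Beta.VariantCutoffRoadExplicit

open Literature.MathematicalPhysics.QuantumFieldTheory.Balaban1983to89
open Literature.MathematicalPhysics.QuantumFieldTheory.Balaban1983to89.Beta
open FlowStep FlowStepRuns DagBinding
open Literature.MathematicalPhysics.QuantumFieldTheory.Balaban1983to89.B13ScaleTransfer (Pt)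
open Literature.MathematicalPhysics.QuantumFieldTheory.Balaban1983to89.Beta.RemainderChain (RemainderConst)
open Literature.MathematicalPhysics.QuantumFieldTheory.Balaban1983to89.Beta.RemainderChainLattice (CondsL SignsL remCoeffL)
open Literature.MathematicalPhysics.QuantumFieldTheory.Balaban1983to89.Beta.RemainderLimitTorus (LDom limKernel)
open Literature.MathematicalPhysics.QuantumFieldTheory.Balaban1983to89.Beta.Drift (OneLoopDrift)
open Literature.MathematicalPhysics.QuantumFieldTheory.Balaban1983to89.Beta.OneStepKernelFamily (TbalOf D1Drift)
open Literature.MathematicalPhysics.QuantumFieldTheory.Balaban1983to89.Beta.OneStepResolventKernel (JetData)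
open Literature.MathematicalPhysics.QuantumFieldTheory.Balaban1983to89.B12Beta (secondMoment)
open Summit.QuantumFields.BalabanUV.Beta.RoadP2Chain (RemainderMod)
open Summit.QuantumFields.BalabanUV.Beta.VariantCutoffRoad
open Summit.QuantumFields.BalabanUV.Beta.RemainderExplicitRoad
open Summit.QuantumFields.BalabanUV.Beta.RemainderExplicitCarrier (carrierBal exists_decay_carrierBal limit_carrierBal)
open Summit.QuantumFields.BalabanUV.Beta.RemainderExplicitEnd (carrierFamily)
open Metric Filter Topology Set

noncomputable section

variable {d : ℕ}

/-! ## §1 The constants record at a substituted slot: three more ε₁-free letters, the signs, and Lemma 3's bound is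
MONOTONE in the slot -/

/-- [folklore] The decay rate `δ₀` of the (190)/(2.61)-type test-configuration decay does not sit in the ε₁ slot. -/
@[simp] theorem withEps_δ₀ (c : B13.Consts) (ε : ℝ) : (withEps c ε).δ₀ = c.δ₀ := rfl

/-- [folklore] The fraction `δ` of the (2.38) exponent does not sit in the ε₁ slot. -/
@[simp] theorem withEps_δ (c : B13.Consts) (ε : ℝ) : (withEps c ε).δ = c.δ := rfl

/-- [folklore] The rate `κ` of the (2.38) exponent does not sit in the ε₁ slot. -/
@[simp] theorem withEps_κ (c : B13.Consts) (ε : ℝ) : (withEps c ε).κ = c.κ := rfl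

/-- [folklore] Substituting twice is substituting once (the last slot value wins). -/
theorem withEps_withEps (c : B13.Consts) (ε ε' : ℝ) : withEps (withEps c ε) ε' = withEps c ε' := rfl

/-- [folklore] **THE OWNER'S SIGN CONDITIONS AT THE SUBSTITUTED SLOT**: on the box `]0,γ]`, `SignsL (withEps c (δ g)) α₂ B₃`
from `Hyps` (`C₃ ≥ 0`, `A₁ ≥ 0`, `γ ≤ e^{−p₀}`) and the [I]-side signs `0 < α₂`, `0 ≤ B₃`, `0 < δ₀`. -/
theorem signsL_withEps {γ : ℝ} {c : B13.Consts} {ℓ A₁ : ℝ} {p₀ : ℕ} (H : Hyps d γ c ℓ A₁ p₀) {α₂ B₃ : ℝ}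
    (hα₂ : 0 < α₂) (hB₃ : 0 ≤ B₃) (hδ₀ : 0 < c.δ₀) {g : ℝ} (hg : 0 < g) (hgγ : g ≤ γ) :
    SignsL (withEps c (deltaOf A₁ p₀ g)) α₂ B₃ :=
  ⟨H.sign_at hg hgγ, hα₂, hB₃, hδ₀⟩

/-- [folklore] **LEMMA 3's (2.38)_ℓ BOUND IS MONOTONE IN THE SLOT** (for `C₃ ≥ 0`): `|H(Z)| ≤ C₃·ε·e^{−…}` with `ε ≤ ε'`
gives `|H(Z)| ≤ C₃·ε'·e^{−…}`.  (So a residual displayed at `δ(g_k)` is a residual displayed at any larger slot, e.g. at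
`δ(γ)` on the box `]0,γ]`, `γ ≤ e^{−p₀}` — §2 `toResidualChain`.) -/
theorem bound238With_mono {S : B13.StepData} {c : B13.Consts} {ℓ ε ε' : ℝ} (hC3 : 0 ≤ c.C3act) (hε : ε ≤ ε')
    (h : B13.Bound238With S (withEps c ε) ℓ) : B13.Bound238With S (withEps c ε') ℓ := by
  intro Z φ hφ
  have h1 := h Z φ hφ
  simp only [C3act_withEps, withEps_eps1, withEps_δ, withEps_κ] at h1 ⊢
  exact h1.trans (mul_le_mul_of_nonneg_right (mul_le_mul_of_nonneg_left hε hC3) (Real.exp_pos _).le)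

/-! ## §2 ROAD P3's residual READ AT THE (3.16) CUT-OFF: `Residual (𝔈 k) (A1 k p) (withEps c (δ g_k)) ℓ α₂` per scale and
history — the δ-chain; restriction to sub-boxes; the δ-chain IS a road-P3 chain at the top-of-box slot -/

/-- [folklore] **THE RESIDUAL IS MONOTONE IN THE SLOT**: co-owner #3's `Residual 𝔈 a (withEps c ε) ℓ α₂` with `ε ≤ ε'`,
`C₃ ≥ 0`, is a `Residual 𝔈 a (withEps c ε') ℓ α₂` — the constants record enters `Residual` ONLY through the Lemma-3
field `h238` (every other field: objects, restriction property, (2.13), the (4.4) seam, analyticity, (4.35) along the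
carrier, (1.7), is record-free), and that field is monotone (`bound238With_mono`). -/
def residualMonoEps {M : ℕ} [NeZero M] {𝔈 : ExplicitCarrier d M} {a : LDom d → Pt d → ℝ} {c : B13.Consts}
    {ℓ α₂ ε ε' : ℝ} (R : Residual 𝔈 a (withEps c ε) ℓ α₂) (hC3 : 0 ≤ c.C3act) (hε : ε ≤ ε') :
    Residual 𝔈 a (withEps c ε') ℓ α₂ where
  W := R.W
  hsp := R.hsp
  hrep := R.hrep
  h238 := fun n => bound238With_mono hC3 hε (R.h238 n)
  EXn := R.EXn
  emb := R.emb
  hemb := R.hemb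
  hcomp := R.hcomp
  E2n := R.E2n
  han := R.han
  hrepr := R.hrepr
  F := R.F
  hF := R.hF
  hfac := R.hfac
  ha := R.ha

/-- **(R_δ) — ROAD P3's RESIDUAL CHAIN READ AT THE (3.16) CUT-OFF.**  For the β-family `β` with one-loop split `S` on
the boxes `]0,γ]^{k+1}`, relative to a SCALE-INDEXED family of explicit carriers `𝔈 k` (co-owner #3's
`RemainderExplicitRoad.ExplicitCarrier`): the infinite-volume localized polarization terms `A1 k p` of the (2.13)-half,
the (1.20)/(1.22) dictionary clause `beta1_eq` on the DEFINED limit kernel `limKernel (A1 k p)`, and for every scale `k`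
and history `p` co-owner #3's residual `Residual (𝔈 k) (A1 k p) (withEps c (δ(g_k))) ℓ α₂`, `g_k = p (Fin.last k)`,
`δ(g) = A₁ g (log g⁻²)^{p₀}` — i.e. EXACTLY `RemainderExplicitRoad.ResidualChain` with its Lemma-3 field displayed at
`C₃·δ(g_k)` ([II] (2.38) read on the (3.16) box `|B| < r_k`, where [II]'s printed ε₁ = the majorant of `g_k|B|` IS
[Balaban1988Convergent]'s `δ_k = g_k r_k`, (1.1)/(1.4) p. 246) instead of `C₃·ε₁`.  ONE `c, ℓ, α₂, A₁, p₀` for all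
`k, p`.  A HYPOTHESIS structure; its instantiation for Bałaban's (variant) objects relative to any carrier is road P1's
NODE O/A/B read at the substituted constants — XL, unowned, nothing of it discharged anywhere in the tree. -/
structure ResidualChainδ (d M : ℕ) [NeZero M] (μ ν : Fin d) {β : HBeta} (S : B12Beta.OneLoopSplit β) (γ : ℝ)
    (c : B13.Consts) (ℓ α₂ A₁ : ℝ) (p₀ : ℕ) (𝔈 : ℕ → ExplicitCarrier d M) where
  /-- infinite-volume localized polarization terms of the (2.13)-half at scale k + 1, history p -/
  A1 : (k : ℕ) → (Fin (k + 1) → ℝ) → LDom d → Pt d → ℝ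
  /-- the (1.20)/(1.22) dictionary: β¹ IS the second moment of the limit kernel -/
  beta1_eq : ∀ k p, p ∈ B12Beta.HistBox γ k →
    S.β1 k p = B12Beta.secondMoment (fun _ _ => limKernel (A1 k p)) μ ν
  /-- co-owner #3's residual at scale k, history p, relative to the carrier `𝔈 k`, WITH LEMMA 3 AT `C₃·δ(g_k)` -/
  res : ∀ k (p : Fin (k + 1) → ℝ), p ∈ B12Beta.HistBox γ k →
    Residual (𝔈 k) (A1 k p) (withEps c (deltaOf A₁ p₀ (p (Fin.last k)))) ℓ α₂

namespace ResidualChainδ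

variable {M : ℕ} [NeZero M] {μ ν : Fin d} {β : HBeta} {S : B12Beta.OneLoopSplit β} {γ : ℝ} {c : B13.Consts}
  {ℓ α₂ A₁ : ℝ} {p₀ : ℕ} {𝔈 : ℕ → ExplicitCarrier d M}

/-- [folklore] Histories in a smaller box are histories in the larger box. -/
theorem histBox_mono {γ γ' : ℝ} (hγ : γ' ≤ γ) {k : ℕ} {p : Fin (k + 1) → ℝ} (hp : p ∈ B12Beta.HistBox γ' k) :
    p ∈ B12Beta.HistBox γ k :=
  fun i => ⟨(hp i).1, (hp i).2.trans hγ⟩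

/-- [folklore] **RESTRICTION TO A SUB-BOX** `]0,γ'] ⊂ ]0,γ]`: the δ-chain is given box by box, so it restricts (the END
shrinks γ; nothing else moves). -/
def restrict (R : ResidualChainδ d M μ ν S γ c ℓ α₂ A₁ p₀ 𝔈) {γ' : ℝ} (hγ : γ' ≤ γ) :
    ResidualChainδ d M μ ν S γ' c ℓ α₂ A₁ p₀ 𝔈 where
  A1 := R.A1
  beta1_eq := fun k p hp => R.beta1_eq k p (histBox_mono hγ hp)
  res := fun k p hp => R.res k p (histBox_mono hγ hp)

/-- [folklore] **THE δ-CHAIN ON `]0,γ]` IS A ROAD-P3 CHAIN AT THE TOP-OF-BOX SLOT `withEps c (δ γ)`** (`C₃ ≥ 0`, `A₁ ≥ 0`,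
`γ ≤ e^{−p₀}`, where `δ` is monotone: `VariantCutoffRoad.deltaOf_mono`).  Road P2″'s input is therefore NOT weaker than
road P3's at the slot `ε₁ := δ(γ)`; what it adds is the bookkeeping that the slot SHRINKS WITH THE BOX, which is what
removes (hr). -/
def toResidualChain (R : ResidualChainδ d M μ ν S γ c ℓ α₂ A₁ p₀ 𝔈) (hC3 : 0 ≤ c.C3act) (hA₁ : 0 ≤ A₁)
    (hbox : γ ≤ Real.exp (-(p₀ : ℝ))) : ResidualChain d M μ ν S γ (withEps c (deltaOf A₁ p₀ γ)) ℓ α₂ 𝔈 where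
  A1 := R.A1
  beta1_eq := R.beta1_eq
  res := fun k p hp => residualMonoEps (R.res k p hp) hC3
    (deltaOf_mono hA₁ p₀ (hp (Fin.last k)).1 (hp (Fin.last k)).2 hbox)

/-! ## §3 (R_δ) ∧ (E) ∧ (V) IS a road-P2″ chain: P3's repackaging ∘ P1's `toPolLeavesT` at the substituted record ∘ P2″'s
`ChainTδ`; the ω-form with THE ROW OWNER's coefficient; the constant form two ways -/

/-- [folklore] **(R_δ) ∧ (E) ∧ (V) IS A ROAD-P2″ CHAIN** `VariantCutoffRoad.ChainTδ d M μ ν S γ c ℓ α₂ B₃ A₁ p₀`: at each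
scale and history, co-owner #3's `Residual.toPolLeavesTFac` (test configurations, their decay (E) and volume limit (V)
from the explicit carrier) followed by the row owner's `RemainderLocality.PolLeavesTFac.toPolLeavesT` RUN AT THE RECORD
`withEps c (δ g_k)` (its three arguments `CondsL`, `R22gen`, `SignsL` at that record supplied by `Hyps.condsL_at`,
`R22gen_withEps`, `signsL_withEps`), the kernel being the DEFINED `limKernel (A1 k p)`.  Pure repackaging. -/
def toChainTδ (R : ResidualChainδ d M μ ν S γ c ℓ α₂ A₁ p₀ 𝔈) (H : Hyps d γ c ℓ A₁ p₀) {B₃ : ℝ}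
    (hE : ∀ k, (𝔈 k).Decay B₃ c.δ₀) (hV : ∀ k, (𝔈 k).Limit) (hα₂ : 0 < α₂) (hB₃ : 0 ≤ B₃) (hδ₀ : 0 < c.δ₀) :
    ChainTδ d M μ ν S γ c ℓ α₂ B₃ A₁ p₀ where
  P1 := fun k p => fun _ _ => limKernel (R.A1 k p)
  beta1_eq := R.beta1_eq
  leaves := fun k p hp =>
    ((R.res k p hp).toPolLeavesTFac (hE k) (hV k)).toPolLeavesT
      (H.condsL_at (hp (Fin.last k)).1 (hp (Fin.last k)).2)
      ((R22gen_withEps c _ ℓ).2 H.R22)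
      (signsL_withEps H hα₂ hB₃ hδ₀ (hp (Fin.last k)).1 (hp (Fin.last k)).2)

/-- [folklore] **THE ω-FORM OF THE REMAINDER BINDER FROM (R_δ) ∧ (E) ∧ (V)**: for EVERY scale k and EVERY history
`p ∈ ]0,γ]^{k+1}`, `|β¹_{k+1}(p)| ≤ δ(g_k) · K_rem,L` with THE ROW OWNER's coefficient `K_rem,L = remCoeffL d M c α₂ B₃`
(`VariantCutoffRoad.ChainTδ.abs_beta1_le` ∘ `toChainTδ`).  Hypotheses: `Hyps` (ε₁-free numeric conditions, R22, `C₃ ≥ 0`,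
`A₁ ≥ 0`, `γ ≤ e^{−p₀}`, Kotecký–Preiss smallness at `δ(γ)`), (E), (V), and the [I]-side signs. -/
theorem abs_beta1_le (R : ResidualChainδ d M μ ν S γ c ℓ α₂ A₁ p₀ 𝔈) (H : Hyps d γ c ℓ A₁ p₀) {B₃ : ℝ}
    (hE : ∀ k, (𝔈 k).Decay B₃ c.δ₀) (hV : ∀ k, (𝔈 k).Limit) (hα₂ : 0 < α₂) (hB₃ : 0 ≤ B₃) (hδ₀ : 0 < c.δ₀)
    (hd : 0 < d) : RemainderMod S γ (fun g => deltaOf A₁ p₀ g * remCoeffL d M c α₂ B₃) :=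
  (R.toChainTδ H hE hV hα₂ hB₃ hδ₀).abs_beta1_le H hα₂ hB₃ hδ₀ hd

/-- [folklore] **THE CONSTANT FORM ON THE BOX**: `RemainderConst S γ (δ(γ) · K_rem,L)` (`ChainTδ.remainderConst` ∘
`toChainTδ`). -/
theorem remainderConst (R : ResidualChainδ d M μ ν S γ c ℓ α₂ A₁ p₀ 𝔈) (H : Hyps d γ c ℓ A₁ p₀) {B₃ : ℝ}
    (hE : ∀ k, (𝔈 k).Decay B₃ c.δ₀) (hV : ∀ k, (𝔈 k).Limit) (hα₂ : 0 < α₂) (hB₃ : 0 ≤ B₃) (hδ₀ : 0 < c.δ₀)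
    (hd : 0 < d) : RemainderConst S γ (deltaOf A₁ p₀ γ * remCoeffL d M c α₂ B₃) :=
  (R.toChainTδ H hE hV hα₂ hB₃ hδ₀).remainderConst H hα₂ hB₃ hδ₀ hd

/-- [folklore] **CONSISTENCY OF THE TWO CO-OWNER ROADS**: the SAME constant form obtained from ROAD P3's OWN END
`ResidualChain.abs_beta1_le` applied to the δ-chain regarded as a road-P3 chain at the top slot (`toResidualChain`) — the
slot reads `(withEps c (δ γ)).ε₁ = δ γ` and the coefficient is slot-free (`remCoeffL_withEps`). -/
theorem remainderConst_via_roadP3 (R : ResidualChainδ d M μ ν S γ c ℓ α₂ A₁ p₀ 𝔈) (H : Hyps d γ c ℓ A₁ p₀) {B₃ : ℝ}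
    (hE : ∀ k, (𝔈 k).Decay B₃ c.δ₀) (hV : ∀ k, (𝔈 k).Limit) (hα₂ : 0 < α₂) (hB₃ : 0 ≤ B₃) (hδ₀ : 0 < c.δ₀)
    (hd : 0 < d) (hγ : 0 < γ) : RemainderConst S γ (deltaOf A₁ p₀ γ * remCoeffL d M c α₂ B₃) := by
  have h := (R.toResidualChain H.C3_nonneg H.A₁_nonneg H.box).abs_beta1_le hE hV (H.condsL_at hγ le_rfl)
    ((R22gen_withEps c _ ℓ).2 H.R22) (signsL_withEps H hα₂ hB₃ hδ₀ hγ le_rfl) hd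
  simpa only [withEps_eps1, remCoeffL_withEps] using h

/-- [folklore] **THE ω-FORM with per-level decay constants and a majorant** («CAP rows + monotone majorant» form of (E), co-owner
#3's `ExplicitCarrier.Decay.uniform_of_levelwise`): per-scale decay pairs `(Bk k, δk k)` dominated by `(B₃, c.δ₀)`. -/
theorem abs_beta1_le_of_levelwise (R : ResidualChainδ d M μ ν S γ c ℓ α₂ A₁ p₀ 𝔈) (H : Hyps d γ c ℓ A₁ p₀)
    {Bk δk : ℕ → ℝ} {B₃ : ℝ} (hEk : ∀ k, (𝔈 k).Decay (Bk k) (δk k)) (hB : ∀ k, Bk k ≤ B₃) (hB₃ : 0 ≤ B₃)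
    (hδ : ∀ k, c.δ₀ ≤ δk k) (hV : ∀ k, (𝔈 k).Limit) (hα₂ : 0 < α₂) (hδ₀ : 0 < c.δ₀) (hd : 0 < d) :
    RemainderMod S γ (fun g => deltaOf A₁ p₀ g * remCoeffL d M c α₂ B₃) :=
  R.abs_beta1_le H (ExplicitCarrier.Decay.uniform_of_levelwise hEk hB hB₃ hδ hδ₀.le) hV hα₂ hB₃ hδ₀ hd

end ResidualChainδ

/-! ## §4 THE WALL END FROM (R_δ) FOR ANY EXPLICIT CARRIER FAMILY — (E), (V) hypotheses, NO (hr), NO N3 -/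

/-- [folklore] **ROADS P3 ⊕ P2″ — THE WALL END, drift letters.**  Binders: `hgen`, the split `S`, a δ-chain `R` on the box
`]0,γ₀]` relative to ANY scale-indexed explicit carrier family `𝔈`, `Hyps`, the carrier's (E) and (V), the [I]-side signs,
the one-loop drift with constant `b > 0` (rows D1/CAP), continuity (row hcont).  Conclusion: `EndpointExistence`.  NO
`r ≤ b` / (hr) hypothesis, NO N3 (`VariantCutoffRoad.endpointExistence_of_chainTδ` ∘ `toChainTδ`: γ shrinks instead). -/
theorem endpointExistence_of_residualChainδ {M : ℕ} [NeZero M] {C : B12.Construction} {β : HBeta}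
    (hgen : ForwardGenerated C β) (S : B12Beta.OneLoopSplit β) {μ ν : Fin d} {γ₀ b Adr : ℝ} {c : B13.Consts}
    {ℓ α₂ B₃ A₁ : ℝ} {p₀ : ℕ} {𝔈 : ℕ → ExplicitCarrier d M} (R : ResidualChainδ d M μ ν S γ₀ c ℓ α₂ A₁ p₀ 𝔈)
    (H : Hyps d γ₀ c ℓ A₁ p₀) (hE : ∀ k, (𝔈 k).Decay B₃ c.δ₀) (hV : ∀ k, (𝔈 k).Limit) (hα₂ : 0 < α₂)
    (hB₃ : 0 ≤ B₃) (hδ₀ : 0 < c.δ₀) (hd : 0 < d) (hγ₀ : 0 < γ₀) (hb : 0 < b) (hdrift : OneLoopDrift b Adr S.β0)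
    (hcont : BetaContH γ₀ β) : EndpointExistence C :=
  endpointExistence_of_chainTδ hgen S (R.toChainTδ H hE hV hα₂ hB₃ hδ₀) H hα₂ hB₃ hδ₀ hd hγ₀ hb hdrift hcont

/-- [folklore] **ROADS P3 ⊕ P2″ — THE WALL END IN THE WALL'S LETTERS** (`OneStepKernelFamily.endpointExistence_of_D1Drift`'s
binders `hβ`, `D1Drift`; d = 4): the drift constant is `stepBal N Lc`, positive for `0 < N`, `1 < Lc`
(`B12Normalization.stepBal_pos`) — these two replace road P3's `hr : ε₁·K_rem,L ≤ stepBal N Lc`. -/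
theorem endpointExistence_of_residualChainδ_D1Drift {M : ℕ} [NeZero M] {Lc : ℕ} [NeZero Lc] {β : HBeta}
    {Cn : B12.Construction} (hgen : ForwardGenerated Cn β) (Sβ : B12Beta.OneLoopSplit β) (Js : ℕ → JetData 3 Lc)
    {N : ℝ} {μ ν : Fin 4} (hβ : ∀ j, Sβ.β0 j = secondMoment (TbalOf Lc Js j) μ ν) (hD : D1Drift Lc Js N μ ν)
    (hN : 0 < N) (hLc : 1 < Lc) {γ₀ : ℝ} (hγ₀ : 0 < γ₀) {c : B13.Consts} {ℓ α₂ B₃ A₁ : ℝ} {p₀ : ℕ}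
    {𝔈 : ℕ → ExplicitCarrier 4 M} (R : ResidualChainδ 4 M μ ν Sβ γ₀ c ℓ α₂ A₁ p₀ 𝔈) (H : Hyps 4 γ₀ c ℓ A₁ p₀)
    (hE : ∀ k, (𝔈 k).Decay B₃ c.δ₀) (hV : ∀ k, (𝔈 k).Limit) (hα₂ : 0 < α₂) (hB₃ : 0 ≤ B₃) (hδ₀ : 0 < c.δ₀)
    (hcont : BetaContH γ₀ β) : EndpointExistence Cn := by
  obtain ⟨A, hA⟩ := hD
  have hβfun : Sβ.β0 = fun j => secondMoment (TbalOf Lc Js j) μ ν := funext hβ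
  have hA' : OneLoopDrift (B12Normalization.stepBal N Lc) A Sβ.β0 := by rw [hβfun]; exact hA
  have hLc' : (1 : ℝ) < (Lc : ℝ) := by exact_mod_cast hLc
  exact endpointExistence_of_residualChainδ hgen Sβ R H hE hV hα₂ hB₃ hδ₀ (by norm_num) hγ₀
    (B12Normalization.stepBal_pos hN hLc') hA' hcont

/-! ## §5 (d = 4) FOR CO-OWNER #3's CONSTRUCTED CARRIER FAMILY `carrierFamily`: (E), (V) discharged BY NAME; the END with
NEITHER (E), (V) NOR (hr) — road P3's `endpointExistence_of_residualChain_carrierBal` with its threshold hypothesis DELETED -/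

section CarrierBal

variable (Lc : ℕ) [NeZero Lc] (Mc : ℕ) [NeZero Mc] (Nn : ℕ → ℕ) [∀ n, NeZero (Nn n)]

/-- [folklore] **THE ω-FORM FROM (R_δ) ALONE, relative to the explicit carrier family**: there are explicit constants
`δ₀⋆ > 0`, `B₃ ≥ 0` (those of `RemainderExplicitCarrier.exists_decay_carrierBal`: ONE pair for every scale) such that for
every β-family with one-loop split, every δ-chain RELATIVE TO `carrierFamily Lc Mc Nn hN μ ν`, `Hyps 4 γ c ℓ A₁ p₀`,
`0 < α₂`, `0 < c.δ₀ ≤ δ₀⋆`:  `|β¹_{k+1}(g_0,…,g_k)| ≤ δ(g_k)·K_rem,L(4, Mc, c, α₂, B₃)` on every box.  Compare road P3's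
`RemainderExplicitEnd.exists_remainderConst_of_residualChain` (constant form `ε₁·K_rem,L`). -/
theorem exists_remainderMod_of_residualChainδ_carrierBal (hN : Tendsto Nn atTop atTop) (μ ν : Fin 4) :
    ∃ δ₀ B₃ : ℝ, 0 < δ₀ ∧ 0 ≤ B₃ ∧
      ∀ {β : HBeta} {S : B12Beta.OneLoopSplit β} {γ : ℝ} {c : B13.Consts} {ℓ α₂ A₁ : ℝ} {p₀ : ℕ}
        (_R : ResidualChainδ 4 Mc μ ν S γ c ℓ α₂ A₁ p₀ (carrierFamily Lc Mc Nn hN μ ν)),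
        Hyps 4 γ c ℓ A₁ p₀ → 0 < α₂ → 0 < c.δ₀ → c.δ₀ ≤ δ₀ →
          RemainderMod S γ (fun g => deltaOf A₁ p₀ g * remCoeffL 4 Mc c α₂ B₃) := by
  obtain ⟨δ₀, B₃, hδ, hB, hdec⟩ := exists_decay_carrierBal Lc Mc μ ν
  refine ⟨δ₀, B₃, hδ, hB, ?_⟩
  intro β S γ c ℓ α₂ A₁ p₀ R H hα₂ hδpos hδle
  have hE : ∀ k, (carrierFamily Lc Mc Nn hN μ ν k).Decay B₃ c.δ₀ :=
    fun k => (hdec k Nn hN).mono _ le_rfl hB hδle hδpos.le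
  have hV : ∀ k, (carrierFamily Lc Mc Nn hN μ ν k).Limit := fun k => limit_carrierBal Lc k Mc Nn hN μ ν
  exact R.abs_beta1_le H hE hV hα₂ hB hδpos (by norm_num)

/-- [folklore] **ROADS P3 ⊕ P2″ — THE WALL's END WITH (E), (V) DISCHARGED AND NO (hr)**: compare LITERALLY road P3's
`RemainderExplicitEnd.endpointExistence_of_residualChain_carrierBal`, whose conclusion reads
`(ResidualChain … → c.δ₀ ≤ δ₀ → c.ε₁ * remCoeffL 4 Mc c α₂ B₃ ≤ B12Normalization.stepBal N Lc → EndpointExistence Cn)`: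
here the residual is read at `δ(g_k)` and the threshold hypothesis is GONE (the wall's `0 < N`, `1 < Lc` and road P2″'s
`Hyps` in place of `CondsL`'s ε₁-smallness).  What remains, exactly: the wall's own binders (`hgen`, `Sβ`, `Js`, row D1's
`hβ` and `D1Drift`, continuity (C)), (R_δ) relative to the explicit carrier family, the ε₁-free numerics, signs, and the
rate choice `c.δ₀ ≤ δ₀⋆`.  Discharges nothing of `BetaPertH` by itself. -/
theorem endpointExistence_of_residualChainδ_carrierBal (hN : Tendsto Nn atTop atTop) {β : HBeta}
    {Cn : B12.Construction} (hgen : ForwardGenerated Cn β) (Sβ : B12Beta.OneLoopSplit β) (Js : ℕ → JetData 3 Lc)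
    {N : ℝ} {μ ν : Fin 4} (hβ : ∀ j, Sβ.β0 j = secondMoment (TbalOf Lc Js j) μ ν) (hD : D1Drift Lc Js N μ ν)
    (hNpos : 0 < N) (hLc : 1 < Lc) {γ₀ : ℝ} (hγ₀ : 0 < γ₀) {c : B13.Consts} {ℓ α₂ A₁ : ℝ} {p₀ : ℕ}
    (H : Hyps 4 γ₀ c ℓ A₁ p₀) (hα₂ : 0 < α₂) (hδpos : 0 < c.δ₀) (hcont : BetaContH γ₀ β) :
    ∃ δ₀ B₃ : ℝ, 0 < δ₀ ∧ 0 ≤ B₃ ∧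
      (ResidualChainδ 4 Mc μ ν Sβ γ₀ c ℓ α₂ A₁ p₀ (carrierFamily Lc Mc Nn hN μ ν) → c.δ₀ ≤ δ₀ →
        EndpointExistence Cn) := by
  obtain ⟨δ₀, B₃, hδ, hB, hdec⟩ := exists_decay_carrierBal Lc Mc μ ν
  refine ⟨δ₀, B₃, hδ, hB, fun R hδle => ?_⟩
  have hE : ∀ k, (carrierFamily Lc Mc Nn hN μ ν k).Decay B₃ c.δ₀ :=
    fun k => (hdec k Nn hN).mono _ le_rfl hB hδle hδpos.le
  have hV : ∀ k, (carrierFamily Lc Mc Nn hN μ ν k).Limit := fun k => limit_carrierBal Lc k Mc Nn hN μ ν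
  exact endpointExistence_of_residualChainδ_D1Drift hgen Sβ Js hβ hD hNpos hLc hγ₀ R H hE hV hα₂ hB hδpos hcont

end CarrierBal

end

end Summit.QuantumFields.BalabanUV.Beta.VariantCutoffRoadExplicit
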